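import Summits.BirchSwinnertonDyer.BirchSwinnertonDyer.Theorems.GoldfeldAllTwistsTwoConverseTwinQuarterTraceChiZTrace
import Summits.BirchSwinnertonDyer.BirchSwinnertonDyer.Theorems.GoldfeldAllTwistsTwoConverseTwinAdditiveTwoPrimesTwistHalvability
import Summits.BirchSwinnertonDyer.BirchSwinnertonDyer.Theorems.GoldfeldAllTwistsTwoConverseTwinBirchTheoremBDoublePrime
import Summits.BirchSwinnertonDyer.BirchSwinnertonDyer.Theorems.GoldfeldAllTwistsTwoConverseTwinAdditiveTorsion
import HarnessLib

set_option linter.dupNamespace false -- namespace `…BirchSwinnertonDyer.BirchSwinnertonDyer…` is the cell's (D-0017 nested layout)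
set_option autoImplicit false

/-!
# LINE B⁗, file T3-I-b: THEOREM B⁗ — `BSD(W, 2)` for every minimal model `W` of `49a1^{(−2qp)}` on the cells C6 ∪ C8 (type β),
# and on C4 (type α) under the ONE explicit hypothesis `h2 : r_an(X₀(49)^{(−qp)}) = 1`, modulo print

Cell `bsd-goldfeld`, seat `bsd-goldfeld-s1p-c3x` (gen 11); planner ORDER (cccxvii) «LINE B⁗ — TRANCHE 3», object T3-I (closer). `--supports
stmt-BirchSwinnertonDyer-19140` as a HELPER (twin″ on a twist-density-ZERO two-prime family); Theses-free; theorems only; no definition, no `sorry`,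
no new fact. HONEST FRAMING: a theorem modulo ≤ seventeen named prints (+ `h2` on C4); twin″ is NOT closed and BSD is not proved by any of this.

THE FRAME (= B″'s, `…TwinBirchTheoremBDoublePrime`): `#Ш_an(W) = 𝔮₄₉ = 8I²t_W²/(n_∞k²t_K²c²w_K²·tq·|u|·c_W)` for the Heegner point `P ∈ X₀(49)(K)`,
`K = ℚ(√−2qp)` (`shaAn_eq_x049HeegnerTwistQuotient_of_heegner`), and `BSD(W,2) ⟺ ord₂ #Ш_an(W) = 0` once `Ш(W)[2] = 0` (T3-D
`sha_two_primary_eq_bot_twoPrimesTwist`) and `rank = r_an = 1` (A⁗ + GZK) — `bsdp_two_iff_shaAn_unit_of_forall_mem_sha`. THE FACTOR TABLE: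
`t_W = 2`, `n_∞ = 1`, `t_K = 2` (T3-I-a core), `w_K = 2`, `ord₂ tq = −1` (`h12`), `|u| = 1` (§0), **`c_W = 64`** (§0: the uniform Tamagawa law at
`d = −2qp`, `8·2·4`), **`k = 1`** (T3-I-a `not_forall_halvable_twoPrimesTwist`), and **`I = [X₀(49)(K) : ℤP] = 4·|D₀.c·Dt.c|·b`, `b` ODD** (§1: the trace
`y`, `P = (D₀.c·Dt.c)•y`, is halved EXACTLY ONCE — T3-I trace re-export of X5β-χ / X5α-χ). Hence `𝔮₄₉ = b²/(2·tq)`, `ord₂ 𝔮₄₉ = 0`.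

* §0 `abs_u_eq_one_of_smul_cm7_quadraticTwist_four_mul`, `tamagawaProduct_eq_sixtyFour_twoPrimesTwist`; §1 `index_zmultiples_eq_of_halvingExactlyOnce`
  (`k`-free), `padicValRat_x049Quotient_eq_zero_of_traceHalving` (the table); §2 `bsdp_two_negTwoPrimesTwist_of_traceHalving` (common road),
  **`bsdp_two_negTwoPrimesTwist_beta_of_print`** (C6 ∪ C8; X5β-χ's sixteen prints + Kolyvagin `hKo`, BY NAME) and
  **`bsdp_two_negTwoPrimesTwist_alpha_of_print`** (C4; X5α-χ's + `hKo` + `h2`).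
NUMERICS: kit j304181 (162/162: `Ш_an` odd square, `Tam = 64`, `I₀ ≡ 2 (4)`, `torsK = 2`, `j = 1`). PLACEMENT: not in print (BCST 2022 Rem. D).
References: [GrossZagier1986] I.(6.3), V.§2; [Gross1984] §§4–5; [GrossLMS1991] Prop. 5.3; [CoatesLiTianZhai2015] Thm 1.2–1.4, 4.4;
[CaiShuTian2014] Thm 1.1; [BurungaleFlach2024] Cor. 2; [Miller2011LMS] Def. 1.1; [SilvermanAEC2009] VII.1.3, VIII.8.3, X.4.9; [Silverman1994] IV.9.4.
-/

noncomputable section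

open scoped Classical IntermediateField

open WeierstrassCurve NumberField Literature.NumberTheory Literature.NumberTheory.EllipticCurves
  Literature.NumberTheory.EllipticCurves.ModularForms Literature.NumberTheory.EllipticCurves.CaiShuTian2014
  Literature.NumberTheory.EllipticCurves.CoatesLiTianZhai2015 WeierstrassCurve.QuadraticDescent
  Summit.BirchSwinnertonDyer.Rank1Residual.P2

namespace Summit.BirchSwinnertonDyer.BirchSwinnertonDyer.Theorems.GoldfeldGoodTwists

/-! ## §0 Two factors: `|u| = 1` and `c_W = 64` -/

section Inputs
/-- **`|Cd.u| = 1` for every globally minimal `W` with `Cd • X₀(49)^{(4d)} = W`**, `d` squarefree with `d ≢ 1 (mod 4)` (the additive cell):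
both sides are global minimal models (`isGloballyMinimal_cellTwist`, tree `isGloballyMinimal_unique_holds`) — the factor `|u|` of `𝔮₄₉`.
[cite: SilvermanAEC2009, VII.1.3(b) and VIII.8.3] [cite: Kraus1989, Prop. 2] -/
theorem abs_u_eq_one_of_smul_cm7_quadraticTwist_four_mul {d : ℤ} (hsq : Squarefree d) (hd4 : d % 4 ≠ 1)
    (W : WeierstrassCurve ℚ) [W.IsGloballyMinimal] (Cd : VariableChange ℚ)
    (hW : Cd • cm7.quadraticTwist (((4 * d : ℤ)) : ℚ) = W) : |(Cd.u : ℚ)| = 1 := by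
  have hd : (((4 * d : ℤ)) : ℚ) ≠ 0 := by
    have := hsq.ne_zero; exact_mod_cast (show (4 * d : ℤ) ≠ 0 by omega)
  haveI := cm7.isElliptic_quadraticTwist hd
  haveI := isGloballyMinimal_cellTwist hsq hd4
  haveI : (Cd • cm7.quadraticTwist (((4 * d : ℤ)) : ℚ)).IsGloballyMinimal := by rw [hW]; infer_instance
  rcases (isGloballyMinimal_unique_holds (cm7.quadraticTwist (((4 * d : ℤ)) : ℚ)) Cd).1 with h | h
  · rw [h]; simp
  · rw [h]; simp

/-- **`∏_p c_p(W) = 64` for every model `W` of `49a1^{(−2qp)}`**, `q, p` distinct odd primes with `(q/7) = −1`, `(p/7) = +1`: the UNIFORM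
Tamagawa law `tamagawaProduct_eq_of_smul_eq_cm7_quadraticTwist` (`d = −2qp` squarefree, `d ≡ 2 (mod 4)`, `7 ∤ d`) reads `8·c_q·c_p = 8·2·4`.
(kit j304181: `Tam(finite) = 64` on 162/162.) [cite: Silverman1994, IV.9.4 and Table 4.1] -/
theorem tamagawaProduct_eq_sixtyFour_twoPrimesTwist {q p : ℕ} (hq : q.Prime) (hp : p.Prime) (hq2 : q ≠ 2) (hp2 : p ≠ 2) (hqp : q ≠ p)
    (hq7 : jacobiSym q 7 = -1) (hp7 : jacobiSym p 7 = 1) (W : WeierstrassCurve ℚ) [W.IsElliptic] (C : VariableChange ℚ)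
    (hC : C • W = cm7.quadraticTwist ((-2 * ((q : ℤ) * p) : ℤ) : ℚ)) : W.tamagawaProduct = 64 := by
  obtain ⟨-, hq7'⟩ := ne_two_and_ne_seven_of_jacobiSym hq7
  have hp7' : p ≠ 7 := by rintro rfl; rw [jacobiSym.mod_left] at hp7; norm_num at hp7
  have hsq : Squarefree (-2 * ((q : ℤ) * p)) := by
    rw [neg_mul]; exact squarefree_neg_two_mul_two_primes hq hp hq2 hp2 hqp
  have hqodd : q % 2 = 1 := Nat.odd_iff.mp (hq.odd_of_ne_two hq2)
  have hpodd : p % 2 = 1 := Nat.odd_iff.mp (hp.odd_of_ne_two hp2)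
  have hd4 : (-2 * ((q : ℤ) * p)) % 4 ≠ 1 := by omega
  have h7 : ¬ (7 : ℤ) ∣ -2 * ((q : ℤ) * p) := by
    rw [neg_mul, dvd_neg]
    intro h
    rcases (Int.Prime.dvd_mul' (by norm_num) h) with h' | h'
    · norm_num at h'
    · rcases (Int.Prime.dvd_mul' (by norm_num) h') with h'' | h''
      · exact hq7' ((Nat.prime_dvd_prime_iff_eq (by norm_num) hq).mp (by exact_mod_cast h'')).symm
      · exact hp7' ((Nat.prime_dvd_prime_iff_eq (by norm_num) hp).mp (by exact_mod_cast h'')).symm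
  rw [tamagawaProduct_eq_of_smul_eq_cm7_quadraticTwist hsq hd4 h7 W C hC]
  have hnat : (-2 * ((q : ℤ) * p)).natAbs = 2 * q * p := by
    rw [Int.natAbs_mul, Int.natAbs_neg, Int.natAbs_mul, Int.natAbs_natCast, Int.natAbs_natCast, mul_assoc]; rfl
  have hpf : (2 * q * p).primeFactors = {2, q, p} := by
    rw [Nat.primeFactors_mul (mul_ne_zero two_ne_zero hq.ne_zero) hp.ne_zero, Nat.primeFactors_mul two_ne_zero hq.ne_zero,
      Nat.prime_two.primeFactors, hq.primeFactors, hp.primeFactors]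
    ext x; simp
  rw [hnat, hpf]
  have h2q : (2 : ℕ) ∉ ({q, p} : Finset ℕ) := by
    simp only [Finset.mem_insert, Finset.mem_singleton, not_or]; exact ⟨hq2.symm, hp2.symm⟩
  have hqp' : q ∉ ({p} : Finset ℕ) := by rw [Finset.mem_singleton]; exact hqp
  rw [show ({2, q, p} : Finset ℕ) = insert 2 {q, p} from rfl, Finset.erase_insert h2q, Finset.prod_insert hqp',
    Finset.prod_singleton, if_pos hq7, if_neg (by rw [hp7]; norm_num)]
  norm_num

/-- The arithmetic of the cells used below (kept OUTSIDE the `K[1]`-world section: `omega` certificates are `decide`d). [folklore] -/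
theorem cells_arith_negEightTwoPrimes {q p : ℕ} (hq4 : q % 4 = 3) (hp8 : p % 8 = 5) :
    ((q : ℤ) * p) % 2 = 1 ∧ (-2 * ((q : ℤ) * p)) % 4 ≠ 1 ∧ 4 * (-(2 * ((q : ℤ) * p))) < 0 := by
  have hq' : (q : ℤ) % 4 = 3 := by exact_mod_cast hq4
  have hp' : (p : ℤ) % 8 = 5 := by exact_mod_cast hp8
  have hodd : ((q : ℤ) * p) % 2 = 1 := by
    rw [Int.mul_emod, show (q : ℤ) % 2 = 1 by omega, show (p : ℤ) % 2 = 1 by omega]; norm_num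
  refine ⟨hodd, by omega, ?_⟩
  have hq0 : (0 : ℤ) < q := by omega
  have hp0 : (0 : ℤ) < p := by omega
  nlinarith [mul_pos hq0 hp0]
end Inputs

/-! ## §1 The `k`-free index from «halved exactly once», and the factor table -/

section Index
variable {K : Type} [Field K] [NumberField K]
/-- **THE INDEX FROM «HALVED EXACTLY ONCE».** `rank X₀(49)(K) = 1`, `#X₀(49)(K)_tors = 2`; `P = n • y` (`n ≠ 0`); `N•y = 2•R₀` for an odd `N`;
and NO `S`, odd `N′`, `t ∈ {O,T}` with `N′•y = 4•S + t`. THEN `[X₀(49)(K) : ℤP] = 4·|n·b|` with `b` ODD. (With `g` a generator mod torsion,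
`y = a•g + τ`, `τ ∈ {O,T}`: `N•y = 2•R₀` forces `a` even and `τ = O`; `a = 2b` with `b` odd, else `y = 4•(b/2•g)`; index formula
`KrizLi2019.index_zmultiples_eq`.) [cite: GrossZagier1986, V.§2 (p. 311)] [cite: SilvermanAEC2009, VIII.6 and Exercise 10.16] -/
theorem index_zmultiples_eq_of_halvingExactlyOnce (htK : (cm7.baseChange K).torsionOrder = 2)
    (hr : (cm7.baseChange K).mordellWeilRank = 1) {P y : (cm7.baseChange K).toAffine.Point} {n : ℤ} (hn : n ≠ 0) (hP : P = n • y)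
    (hhalf : ∃ (N : ℤ) (R₀ : (cm7.baseChange K).toAffine.Point), Odd N ∧ N • y = (2 : ℤ) • R₀)
    (hno4 : ¬ ∃ (S : (cm7.baseChange K).toAffine.Point) (N' : ℤ) (t : (cm7.baseChange K).toAffine.Point), Odd N' ∧
      (t = 0 ∨ t = Affine.Point.some 2 (-1) (nonsingular_cm7_baseChange_two_neg_one K)) ∧ N' • y = (4 : ℤ) • S + t) :
    ∃ b : ℤ, Odd b ∧ (AddSubgroup.zmultiples P).index = (n * b).natAbs * 4 := by
  haveI : NeZero (2 : ℚ) := ⟨two_ne_zero⟩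
  set T := Affine.Point.some 2 (-1) (nonsingular_cm7_baseChange_two_neg_one K) with hT
  have hT2 : T + T = 0 := cm7_twoTorsion_add_self K
  -- a Mordell–Weil basis with ONE element
  obtain ⟨P₁, hP₁⟩ := (cm7.baseChange K).exists_isMordellWeilBasis_holds
  have hB : IsMordellWeilBasis (P₁ ∘ finCongr hr.symm) := isMordellWeilBasis_comp_equiv hP₁ _
  set g := (P₁ ∘ finCongr hr.symm) 0 with hg_def
  have hg : ¬ IsOfFinAddOrder g := by
    intro hfin
    have hne := hB.1.ne_zero 0
    apply hne
    change (QuotientAddGroup.mk g : mordellWeilModTorsion (cm7.baseChange K)) = 0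
    exact (QuotientAddGroup.eq_zero_iff _).mpr ((AddCommGroup.mem_torsion _).mpr hfin)
  have hgen : ∀ z : (cm7.baseChange K).toAffine.Point, ∃ m : ℤ,
      z - m • g ∈ AddCommGroup.torsion (cm7.baseChange K).toAffine.Point := fun z => by
    obtain ⟨a, ha⟩ := exists_sub_zsmul_isOfFinAddOrder_of_isMordellWeilBasis hB z
    exact ⟨a, (AddCommGroup.mem_torsion _).mpr ha⟩
  have hcoord : ∀ z : (cm7.baseChange K).toAffine.Point, ∃ (a : ℤ) (t : (cm7.baseChange K).toAffine.Point),
      IsOfFinAddOrder t ∧ z = a • g + t := fun z => by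
    obtain ⟨a, ha⟩ := exists_sub_zsmul_isOfFinAddOrder_of_isMordellWeilBasis hB z
    exact ⟨a, z - a • g, ha, by abel⟩
  have hzs : ∀ c : ℤ, IsOfFinAddOrder (c • g) → c = 0 := by
    intro c hc
    by_contra hc0
    exact hg (Literature.NumberTheory.EllipticCurves.isOfFinAddOrder_of_zsmul hc0 hc)
  -- torsion points are `O` or `T`; all are killed by `2` and fixed by odd multiples
  have htor : ∀ t : (cm7.baseChange K).toAffine.Point, IsOfFinAddOrder t → (2 : ℤ) • t = 0 := by
    intro t ht
    rcases eq_zero_or_eq_twoTorsion_of_isOfFinAddOrder htK ht with rfl | rfl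
    · rw [smul_zero]
    · rw [two_zsmul]; exact hT2
  -- the coordinate of `y`: `y = a • g + τ`, and `N•y = 2•R₀` gives `N•a = 2•r`, `N•τ = 0`
  obtain ⟨a, τ, hτ, hy⟩ := hcoord y
  obtain ⟨N, R₀, hNodd, hNy⟩ := hhalf
  obtain ⟨r, τ', hτ', hR₀⟩ := hcoord R₀
  have hτN : N • τ = τ := by
    rcases eq_zero_or_eq_twoTorsion_of_isOfFinAddOrder htK hτ with rfl | rfl
    · rw [smul_zero]
    · exact zsmul_eq_self_of_odd_of_add_self_eq_zero hT2 hNodd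
  have key : (N * a - 2 * r) • g = -τ := by
    have e1 : N • y = (N * a) • g + τ := by rw [hy, smul_add, smul_smul, hτN]
    have e2 : (2 : ℤ) • R₀ = (2 * r) • g := by rw [hR₀, smul_add, smul_smul, htor τ' hτ', add_zero]
    rw [sub_smul, ← e2, ← hNy, e1]; abel
  have hfin : IsOfFinAddOrder ((N * a - 2 * r) • g) := by rw [key]; exact hτ.neg
  have hNa : N * a - 2 * r = 0 := hzs _ hfin
  have hτ0 : τ = 0 := by
    have : -τ = 0 := by rw [← key, hNa, zero_smul]
    exact neg_eq_zero.mp this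
  -- `a` is even: `a = 2b`
  have ha2 : (2 : ℤ) ∣ a := by
    have h2 : (2 : ℤ) ∣ N * a := ⟨r, by linarith⟩
    exact (Int.prime_two.dvd_or_dvd h2).resolve_left fun h => (Int.not_even_iff_odd.mpr hNodd) (even_iff_two_dvd.mpr h)
  obtain ⟨b, hab⟩ := ha2
  -- `b` is odd, else `y = 4 • (b/2 • g)`
  have hb : Odd b := by
    by_contra hodd
    obtain ⟨c, hc⟩ := Int.not_odd_iff_even.mp hodd
    refine hno4 ⟨c • g, 1, 0, odd_one, Or.inl rfl, ?_⟩
    rw [one_smul, add_zero, hy, hτ0, add_zero, hab, hc, smul_smul]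
    congr 1; ring
  refine ⟨b, hb, ?_⟩
  have hx : P - (n * b * 2) • g ∈ AddCommGroup.torsion (cm7.baseChange K).toAffine.Point := by
    rw [hP, hy, hτ0, add_zero, hab, smul_smul, show n * (2 * b) = n * b * 2 by ring, sub_self]
    exact zero_mem _
  have hb0 : b ≠ 0 := fun h => by simp [h] at hb
  rw [KrizLi2019.index_zmultiples_eq (cm7.baseChange K) hg hgen (mul_ne_zero (mul_ne_zero hn hb0) two_ne_zero) hx, htK,
    Int.natAbs_mul, show (2 : ℤ).natAbs = 2 from rfl]
  ring


/-- **THE FACTOR TABLE at `k = 1`.** `K` imaginary quadratic with `d_K = −8qp` (`q, p` distinct odd primes `≠ 7`, `(q/7) = −1`, `(p/7) = +1`),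
`P = (D₀.c·Dt.c) • y` in `X₀(49)(K)` with `|D₀.c| = 1` (the trace relation of a Heegner point of a datum `Dt` against the conductor-`1` trace `y`
of an optimal datum `D₀`), `y` halved EXACTLY ONCE (`N•y = 2•R₀`, no `N′•y = 4•S + t`), `rank X₀(49)(K) = 1`, and `W = Cd • X₀(49)^{(d_K)}`
globally minimal. Then `ord₂ (x049HeegnerTwistQuotient K P Dt.c 1 W Cd.u) = 0`: `I = 4|Dt.c|·b` (§1), `t_W = t_K = w_K = 2`, `n_∞ = |u| = 1`,
`c_W = 64`, `ord₂ tq = −1` (`h12`) ⇒ `𝔮₄₉ = b²/(2tq)`. [cite: GrossZagier1986, V.§2 (p. 311)] [cite: CoatesLiTianZhai2015, Thm. 1.2 (p. 359)]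
[cite: Silverman1994, IV.9.4] [cite: SilvermanAEC2009, VII.1.3(b) and VIII.8.3] -/
theorem padicValRat_x049Quotient_eq_zero_of_halvingExactlyOnce (h12 : thm12_fullBSD_twist) (hK : IsImaginaryQuadratic K)
    {q p : ℕ} (hq : q.Prime) (hp : p.Prime) (hq2 : q ≠ 2) (hp2 : p ≠ 2) (hqp : q ≠ p) (hp7' : p ≠ 7)
    (hq7 : jacobiSym q 7 = -1) (hpj : jacobiSym p 7 = 1) (hdK : NumberField.discr K = -(8 * (q : ℤ) * p))
    (Dt D₀ : ModularParametrizationData cm7 49) (hc : |D₀.c| = 1) {P y : (cm7.baseChange K).toAffine.Point}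
    (hP : P = (D₀.c * Dt.c) • y) (hrK : (cm7.baseChange K).mordellWeilRank = 1)
    (hhalf : ∃ (N : ℤ) (R₀ : (cm7.baseChange K).toAffine.Point), Odd N ∧ N • y = (2 : ℤ) • R₀)
    (hno4 : ¬ ∃ (S : (cm7.baseChange K).toAffine.Point) (N' : ℤ) (t : (cm7.baseChange K).toAffine.Point), Odd N' ∧
      (t = 0 ∨ t = Affine.Point.some 2 (-1) (nonsingular_cm7_baseChange_two_neg_one K)) ∧ N' • y = (4 : ℤ) • S + t)
    (W : WeierstrassCurve ℚ) [W.IsElliptic] [W.IsGloballyMinimal] (Cd : VariableChange ℚ)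
    (hW : Cd • cm7.quadraticTwist (NumberField.discr K : ℚ) = W) :
    padicValRat 2 (x049HeegnerTwistQuotient K P Dt.c 1 W Cd.u) = 0 := by
  obtain ⟨-, hq7'⟩ := ne_two_and_ne_seven_of_jacobiSym hq7
  have hn : D₀.c * Dt.c ≠ 0 := mul_ne_zero D₀.maninConstant_ne_zero_holds Dt.maninConstant_ne_zero_holds
  have htK : (cm7.baseChange K).torsionOrder = 2 := torsionOrder_cm7_baseChange_eq_two_negEightTwoPrimes hK hq hp hq7' hp7' hdK
  obtain ⟨b, hb, hI⟩ := index_zmultiples_eq_of_halvingExactlyOnce htK hrK hn hP hhalf hno4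
  have hd0 : (NumberField.discr K : ℚ) ≠ 0 := by exact_mod_cast NumberField.discr_ne_zero K
  haveI := cm7.isElliptic_quadraticTwist hd0
  have hjW : W.j = -3375 ∨ W.j = 16581375 := by
    left
    subst hW
    rw [variableChange_j, j_quadraticTwist _ hd0, j_cm7]
  have htW : W.torsionOrder = 2 := torsionOrder_eq_two_of_j_eq W hjW
  have hninf : (cm7.baseChange ℝ).numRealComponents = 1 := numRealComponents_cm7
  have hwK : Units.torsionOrder K = 2 :=
    QuadraticFields.Quadratic.torsionOrder_eq_two_of_discr_lt_neg_four hK.1 (by rw [hdK]; have := hq.two_le; have := hp.two_le; nlinarith)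
  have htq := padicValRat_two_twinQuotient_cm7 h12
  have htq0 := twinQuotient_cm7_ne_zero h12
  have hsq : Squarefree (-2 * ((q : ℤ) * p)) := by rw [neg_mul]; exact squarefree_neg_two_mul_two_primes hq hp hq2 hp2 hqp
  have hqodd : q % 2 = 1 := Nat.odd_iff.mp (hq.odd_of_ne_two hq2)
  have hpodd : p % 2 = 1 := Nat.odd_iff.mp (hp.odd_of_ne_two hp2)
  have hW4 : Cd • cm7.quadraticTwist (((4 * (-2 * ((q : ℤ) * p)) : ℤ)) : ℚ) = W := by
    rw [← hW, hdK]; congr 2; push_cast; ring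
  have hu : |(Cd.u : ℚ)| = 1 := abs_u_eq_one_of_smul_cm7_quadraticTwist_four_mul hsq (by omega) W Cd hW4
  have hdK8 : NumberField.discr K = -(8 * ((q * p : ℕ) : ℤ)) := by rw [hdK]; push_cast; ring
  obtain ⟨C, hC⟩ := exists_smul_eq_quadraticTwist_negTwo_of_discr K hdK8 W Cd hW
  have hC' : C • W = cm7.quadraticTwist ((-2 * ((q : ℤ) * p) : ℤ) : ℚ) := by rw [hC]; push_cast; ring_nf
  have hcW : W.tamagawaProduct = 64 := tamagawaProduct_eq_sixtyFour_twoPrimesTwist hq hp hq2 hp2 hqp hq7 hpj W C hC'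
  have hD₀c : ((D₀.c : ℚ)) ^ 2 = 1 := by
    have h' : D₀.c ^ 2 = 1 := by rw [← sq_abs, hc, one_pow]
    exact_mod_cast h'
  have hI2 : (((AddSubgroup.zmultiples P).index : ℕ) : ℚ) ^ 2 = 16 * (Dt.c : ℚ) ^ 2 * (b : ℚ) ^ 2 := by
    rw [hI, Nat.cast_mul, Nat.cast_natAbs, mul_pow, Int.cast_abs, sq_abs]
    push_cast
    linear_combination (16 * (Dt.c : ℚ) ^ 2 * (b : ℚ) ^ 2) * hD₀c
  have hc0 : (Dt.c : ℚ) ≠ 0 := by exact_mod_cast Dt.maninConstant_ne_zero_holds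
  -- `𝔮₄₉ = b² / (2 · tq)`
  have e : x049HeegnerTwistQuotient K P Dt.c 1 W Cd.u = (b : ℚ) ^ 2 / (2 * twinQuotient cm7) := by
    unfold x049HeegnerTwistQuotient
    rw [hI2, htW, hninf, htK, hwK, hu, hcW]
    push_cast
    field_simp
    ring
  rw [e]
  exact padicValRat_sq_div_two_mul hb htq0 htq
end Index

/-! ## §2 THEOREM B⁗ on the cells (in the cell's `K[1]`-world: the trace relation and the trace re-export live there) -/

section Closers
-- the cell's point-group world over `K[1]` / `ℂ` (A2a″'s, X1's, X5's); section-local. No `omega`/`decide` below (helpers of §0 instead).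
attribute [local instance 2000] Classical.propDecidable

/-- **THE COMMON ROAD OF THEOREM B⁗.** `W` globally minimal with `C • W = X₀(49)^{(−2qp)}` on the cells (T3-D's `hq4 hq7 hp8 hp7 hpq hcell`),
`r_an(W) = rank W(ℚ) = 1`, and halving-exactly-once for the explicit trace over every imaginary quadratic `K` with `d_K = −8qp` (`htrace`, the
shape of the T3-I trace re-export) ⇒ `BSD(W, 2)`: T3-D (`Ш(W)[2] = 0`) ⇒ `BSD(W,2) ⟺ ord₂ #Ш_an = 0`; `K = ℚ(√−2qp)`, a Heegner point (`hnew`),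
`Cd • X₀(49)^{(d_K)} = W`; `#Ш_an = 𝔮₄₉` with ITS `k`, `k = 1` (T3-I-a); the optimal datum (`hM`), the trace relation, the factor table.
[cite: Miller2011LMS, Def. 1.1] [cite: GrossZagier1986, Thm. I.(6.3) and V.§2] [cite: BurungaleFlach2024, Cor. 2] [cite: GrossLMS1991, §4 (4.1)] -/
theorem bsdp_two_negTwoPrimesTwist_of_traceHalving (hnew : exists_isNewformOf) (h12 : thm12_fullBSD_twist) (hBF : bsdTriple_of_hasCM_of_L_one_ne_zero)
    (hGZ : ∀ (N : ℕ) [NeZero N] (W : WeierstrassCurve ℚ) (K : Type) [Field K] [NumberField K], gross_zagier N W K)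
    (hKo : ∀ (N : ℕ) [NeZero N] (W : WeierstrassCurve ℚ) (K : Type) [Field K] [NumberField K], kolyvagin N W K)
    (hGZK : rank_eq_analyticRank_of_analyticRank_le_one) (hM : OptimalCurveManinCertificate cm7)
    {q p : ℕ} [Fact q.Prime] [Fact p.Prime] (hq4 : q % 4 = 3) (hq7 : jacobiSym q 7 = -1) (hp8 : p % 8 = 5) (hp7 : legendreSym p (-7) = 1)
    (hpq : jacobiSym p q = -1) (hcell : q % 8 = 7 ∨ ∃ x : ZMod p, x ^ 4 = -7)
    (W : WeierstrassCurve ℚ) [W.IsElliptic] [W.IsGloballyMinimal] (C : VariableChange ℚ)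
    (hC : C • W = cm7.quadraticTwist ((-2 * ((q : ℤ) * p) : ℤ) : ℚ)) (har : W.analyticRank = 1) (hrk : W.mordellWeilRank = 1)
    (htrace : ∀ (K : Type) [Field K] [NumberField K], IsImaginaryQuadratic K → NumberField.discr K = -(8 * (q : ℤ) * p) →
      ∀ (ι : K →+* ℂ) [FiniteDimensional K (ringClassField K ι 1)] [IsGalois K (ringClassField K ι 1)]
        (D₀ : ModularParametrizationData cm7 49), |D₀.c| = 1 → ∀ (β : ℤ) (d : KolyvaginHeegnerData D₀ β ι 1),
        ∃ y : (cm7.baseChange K).toAffine.Point,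
          Affine.Point.map (W' := cm7) (algebraMap K (ringClassField K ι 1)).toRatAlgHom y =
            ∑ σ : ringClassField K ι 1 ≃ₐ[K] ringClassField K ι 1,
              Affine.Point.map (σ : ringClassField K ι 1 →ₐ[K] ringClassField K ι 1) d.y ∧
          (∃ (N : ℤ) (R₀ : (cm7.baseChange K).toAffine.Point), Odd N ∧ N • y = (2 : ℤ) • R₀) ∧
          ¬ ∃ (S : (cm7.baseChange K).toAffine.Point) (N' : ℤ) (t' : (cm7.baseChange K).toAffine.Point), Odd N' ∧
              (t' = 0 ∨ t' = Affine.Point.some 2 (-1) (nonsingular_cm7_baseChange_two_neg_one K)) ∧ N' • y = (4 : ℤ) • S + t') :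
    BSDp W 2 := by
  haveI : cm7.IsGloballyMinimal := Summit.BirchSwinnertonDyer.Rank1Residual.X12.O11.RouteU.isGloballyMinimal_X049_eq
  have hq : q.Prime := Fact.out
  have hp : p.Prime := Fact.out
  obtain ⟨-, hq2, -, -⟩ := mod_four_three_split hq4
  obtain ⟨hp2, hp7', -⟩ := prime_ne_two_ne_seven_of_mod_eight_five hp8
  obtain ⟨-, hqp, -, -, -⟩ := arith_negEightTwoPrimes hq4 hp8
  obtain ⟨hodd, -, hneg⟩ := cells_arith_negEightTwoPrimes hq4 hp8
  have hpj : jacobiSym p 7 = 1 := by rw [← legendreSym_neg_seven_eq_jacobiSym hp2]; exact hp7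
  obtain ⟨h2, -, -⟩ := sha_two_primary_eq_bot_twoPrimesTwist hq4 hq7 hp8 hp7 hpq hcell W C hC hrk
  obtain ⟨-, hiff⟩ := bsdp_two_iff_shaAn_unit_of_forall_mem_sha W h2 (hrk.trans har.symm)
  ------------------------------------------------------------------ `K = ℚ(√−2qp)`, a Heegner point, `Cd • X₀(49)^{(d_K)} = W`
  have hsq : Squarefree (-(2 * ((q : ℤ) * p))) := squarefree_neg_two_mul_two_primes hq hp hq2 hp2 hqp
  obtain ⟨h4dvd, hmod4, hdiv⟩ := discr_arith_negEight_odd hodd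
  obtain ⟨K, _, _, h2K, hdK⟩ := QuadraticFields.Quadratic.exists_numberField_discr_eq (D := 4 * (-(2 * ((q : ℤ) * p))))
    (Or.inr ⟨h4dvd, hmod4, by rw [hdiv]; exact hsq⟩)
  have hK : IsImaginaryQuadratic K := isImaginaryQuadratic_iff_discr_neg.mpr ⟨h2K, by rw [hdK]; exact hneg⟩
  have hdK' : NumberField.discr K = -(8 * (q : ℤ) * p) := by rw [hdK]; ring
  have hdK8 : NumberField.discr K = -(8 * ((q * p : ℕ) : ℤ)) := by rw [hdK]; push_cast; ring
  haveI : NeZero (cm7.conductorNorm ℤ) := ⟨(cm7.conductorNorm_pos_holds).ne'⟩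
  have hH : SatisfiesHeegnerHypothesis 49 K := satisfiesHeegnerHypothesis_fortyNine_negEightTwoPrimes hK hq7 hpj hdK'
  have hH' : SatisfiesHeegnerHypothesis (cm7.conductorNorm ℤ) K := by rw [conductorNorm_cm7]; exact hH
  obtain ⟨P, hP0⟩ := exists_isHeegnerPoint_of_exists_isNewformOf_of_maninConstant cm7 K hnew
    IsNewformOf.exists_maninConstant_ne_zero_holds hK hH'
  obtain ⟨Dt, H, ι, hPH⟩ := isHeegnerPoint_of_level_eq conductorNorm_cm7 hP0
  obtain ⟨Cd, hCd⟩ := exists_smul_twist_discr_eq_of_smul_eq_twist_negTwo K hdK8 W C (by rw [hC]; push_cast; ring_nf)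
  ------------------------------------------------------------------ `#Ш_an = 𝔮₄₉` with ITS `k`, and `k = 1`
  obtain ⟨-, hrK, -, k, hk12, hkiff, hsha⟩ := shaAn_eq_x049HeegnerTwistQuotient_of_heegner hnew h12 hBF hGZ hKo hGZK K hK hH
    Dt H ι P hPH W Cd hCd har
  have hk1 : k = 1 := by
    rcases hk12 with h | h
    · exact h
    · exact absurd (hkiff.mp h) (not_forall_halvable_twoPrimesTwist hK hq4 hq7 hp8 hp7 hpq hcell hdK' W C hC hrk)
  rw [hk1] at hsha
  refine hiff.mpr ⟨_, hsha, ?_⟩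
  ------------------------------------------------------------------ the trace of the optimal datum: `P = (D₀.c·Dt.c) • y`, `y` halved exactly once
  obtain ⟨hN, D, -, hD', -⟩ := hM.exists_optimalDatum_abs_maninConstant_eq_one
  haveI := hN
  obtain ⟨D₀, hc⟩ := exists_datum_abs_c_eq_one_of_level_eq conductorNorm_cm7 D hD'
  obtain ⟨d⟩ := exists_kolyvaginHeegnerData_one (phi_heegnerTau_mem_singularModuliField_holds 49 cm7 K) hK D₀ H.β ι H.dvd_sq_sub
  obtain ⟨hfd, hgal⟩ := finiteDimensional_and_isGalois_ringClassField hK ι one_ne_zero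
  haveI := hfd
  haveI := hgal
  obtain ⟨y, hy, hhalf, hno4⟩ := htrace K hK hdK' ι D₀ hc H.β d
  obtain ⟨-, htr⟩ := map_eq_zsmul_sum_algEquiv_of_abs_c_eq_one (heegnerPointOfConductor_one_galoisConj_holds 49 cm7 K) hK hH Dt
    D₀ hc H d hPH
  rw [← hy, ← map_zsmul] at htr
  have hPy : P = (D₀.c * Dt.c) • y :=
    Affine.Point.map_injective (W' := cm7) (f := (algebraMap K (ringClassField K ι 1)).toRatAlgHom) htr
  exact padicValRat_x049Quotient_eq_zero_of_halvingExactlyOnce h12 hK hq hp hq2 hp2 hqp hp7' hq7 hpj hdK' Dt D₀ hc hPy hrK hhalf hno4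
    W Cd hCd

/-- **THEOREM B⁗ (cells C6 ∪ C8, type β) FROM PRINT: `BSD(W, 2)` for EVERY globally minimal elliptic `W/ℚ` with `C • W = X₀(49)^{(−2qp)}`**,
`q > 3` prime, `q ≡ 3 (mod 4)`, `(q/7) = −1`; `p ≡ 5 (mod 8)` prime, `(−7/p) = +1`, `−7` a fourth power mod `p`; `(p/q) = −1` — granted EXACTLY
X5β-χ's prints (`hCST hGZ h12 h44 h13 h14 hS31 hnew hM hBT hBF hGZK hEta hEta₀ hD`) and Kolyvagin `hKo`: A⁗_β′ (`r_an(W) = rank = 1`), the T3-I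
trace re-export (β), the common road. Twist-density ZERO; twin″ is NOT closed; BSD is not proved; not in print (BCST 2022 Rem. D: even `d_K`).
[cite: Miller2011LMS, Def. 1.1] [cite: GrossZagier1986, Thm. I.(6.3) and V.§2] [cite: CoatesLiTianZhai2015, Thm. 1.2 (p. 359), 1.3, 1.4 and 4.4]
[cite: BurungaleCastellaSkinnerTian2022, Rem. D (p. 327)] -/
theorem bsdp_two_negTwoPrimesTwist_beta_of_print (hCST : thm11_ringClassChar)
    (hGZ : ∀ (N : ℕ) [NeZero N] (W : WeierstrassCurve ℚ) (K : Type) [Field K] [NumberField K], gross_zagier N W K)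
    (h12 : thm12_fullBSD_twist) (h44 : thm44_ord_two_LAlg) (h13 : thm13_ord_two_LAlg) (h14 : thm14_rankOne_twist)
    (hS31 : bsdTriple_of_rank_le_one_of_conductor_lt) (hnew : exists_isNewformOf) (hM : OptimalCurveManinCertificate cm7)
    (hBT : burungaleTian_analyticRank_eq_zero_of_selmerCorank_eq_zero_of_hasCM) (hBF : bsdTriple_of_hasCM_of_L_one_ne_zero)
    (hGZK : rank_eq_analyticRank_of_analyticRank_le_one) (hEta : x049_heegner_norm_x_sub_two_not_mem)
    (hEta₀ : x049_x_sub_two_eq_etaQuotient) (hD : deuring_etaQuotient49_heegner_generates_conjPrime)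
    (hKo : ∀ (N : ℕ) [NeZero N] (W : WeierstrassCurve ℚ) (K : Type) [Field K] [NumberField K], kolyvagin N W K)
    {q p : ℕ} (hq : q.Prime) (h3 : 3 < q) (hq4 : q % 4 = 3) (hq7 : jacobiSym q 7 = -1)
    [Fact p.Prime] (hp8 : p % 8 = 5) (hp7 : legendreSym p (-7) = 1) (hβ : ∃ x : ZMod p, x ^ 4 = -7) (hpq : jacobiSym (p : ℤ) q = -1)
    (W : WeierstrassCurve ℚ) [W.IsElliptic] [W.IsGloballyMinimal] (C : VariableChange ℚ)
    (hC : C • W = cm7.quadraticTwist (-(2 * (q : ℚ) * p))) : BSDp W 2 := by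
  haveI := Fact.mk hq
  obtain ⟨har, hrk, -⟩ := analyticRank_eq_one_twoPrimesTwist_beta_of_print' hCST hGZ h12 h44 h13 h14 hS31 hnew hM hBT hBF hGZK hEta
    hq h3 hq4 hq7 hp8 hp7 hβ hpq W C hC
  have hC' : C • W = cm7.quadraticTwist ((-2 * ((q : ℤ) * p) : ℤ) : ℚ) := by rw [hC]; push_cast; ring_nf
  exact bsdp_two_negTwoPrimesTwist_of_traceHalving hnew h12 hBF hGZ hKo hGZK hM hq4 hq7 hp8 hp7 hpq (Or.inr hβ) W C hC' har hrk
    fun K _ _ hK hdK ι _ _ D₀ hc β d ↦ trace_halvingExactlyOnce_negEightTwoPrimes_beta_of_print hCST hGZ h12 h44 h13 h14 hS31 hnew hM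
      hBT hBF hGZK hEta hEta₀ hD hq h3 hq4 hq7 hp8 hp7 hβ hpq hK hdK ι D₀ hc d

/-- **THEOREM B⁗ (cell C4, type α) FROM PRINT, under the ONE explicit hypothesis `h2 : r_an(X₀(49)^{(−qp)}) = 1`: `BSD(W, 2)` for EVERY
globally minimal elliptic `W/ℚ` with `C • W = X₀(49)^{(−2qp)}`**, `q ≡ 7 (mod 8)` prime, `(q/7) = −1`; `p ≡ 5 (mod 8)` prime, `(−7/p) = +1`, `−7`
NOT a fourth power mod `p`; `(p/q) = −1` — X5α-χ's prints, Kolyvagin `hKo`, and `h2` (item 19350's rank-one `2`-converse width, tree shape; X0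
discharges it on the cells): A⁗_α, the α trace re-export, the common road. [cite: Miller2011LMS, Def. 1.1] [cite: GrossZagier1986, Thm. I.(6.3) and V.§2]
[cite: CoatesLiTianZhai2015, Thm. 1.2 (p. 359), 1.4 and 4.4] [cite: BurungaleCastellaSkinnerTian2022, Rem. D (p. 327)] -/
theorem bsdp_two_negTwoPrimesTwist_alpha_of_print (hCST : thm11_ringClassChar)
    (hGZ : ∀ (N : ℕ) [NeZero N] (W : WeierstrassCurve ℚ) (K : Type) [Field K] [NumberField K], gross_zagier N W K)
    (h12 : thm12_fullBSD_twist) (h44 : thm44_ord_two_LAlg) (h14 : thm14_rankOne_twist)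
    (hS31 : bsdTriple_of_rank_le_one_of_conductor_lt) (hnew : exists_isNewformOf) (hM : OptimalCurveManinCertificate cm7)
    (hBT : burungaleTian_analyticRank_eq_zero_of_selmerCorank_eq_zero_of_hasCM) (hBF : bsdTriple_of_hasCM_of_L_one_ne_zero)
    (hGZK : rank_eq_analyticRank_of_analyticRank_le_one) (hEta : x049_heegner_norm_x_sub_two_not_mem)
    (hEta₀ : x049_x_sub_two_eq_etaQuotient) (hD : deuring_etaQuotient49_heegner_generates_conjPrime)
    (hKo : ∀ (N : ℕ) [NeZero N] (W : WeierstrassCurve ℚ) (K : Type) [Field K] [NumberField K], kolyvagin N W K)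
    {q p : ℕ} (hq : q.Prime) (hq8 : q % 8 = 7) (hq7 : jacobiSym q 7 = -1)
    [Fact p.Prime] (hp8 : p % 8 = 5) (hp7 : legendreSym p (-7) = 1) (hα : ¬ ∃ x : ZMod p, x ^ 4 = -7) (hpq : jacobiSym (p : ℤ) q = -1)
    (h2 : (haveI := cm7.isElliptic_quadraticTwist (show (-((q : ℚ) * p)) ≠ 0 from neg_ne_zero.mpr (mul_ne_zero
        (by exact_mod_cast hq.ne_zero) (by exact_mod_cast (Fact.out : p.Prime).ne_zero)));
      (cm7.quadraticTwist (-((q : ℚ) * p))).analyticRank) = 1)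
    (W : WeierstrassCurve ℚ) [W.IsElliptic] [W.IsGloballyMinimal] (C : VariableChange ℚ)
    (hC : C • W = cm7.quadraticTwist (-(2 * (q : ℚ) * p))) : BSDp W 2 := by
  haveI := Fact.mk hq
  obtain ⟨hq4, h3, -, -⟩ := mod_eight_eq_seven_arith hq8
  obtain ⟨har, hrk, -⟩ := analyticRank_eq_one_twoPrimesTwist_alpha_of_print hCST hGZ h12 h44 h14 hS31 hnew hM hBT hBF hGZK hq h3 hq8
    hq7 hp8 hp7 hα hpq W C hC
  have hC' : C • W = cm7.quadraticTwist ((-2 * ((q : ℤ) * p) : ℤ) : ℚ) := by rw [hC]; push_cast; ring_nf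
  exact bsdp_two_negTwoPrimesTwist_of_traceHalving hnew h12 hBF hGZ hKo hGZK hM hq4 hq7 hp8 hp7 hpq (Or.inl hq8) W C hC' har hrk
    fun K _ _ hK hdK ι _ _ D₀ hc β d ↦ trace_halvingExactlyOnce_negEightTwoPrimes_alpha_of_print hCST hGZ h12 h44 h14 hS31 hnew hM
      hBT hBF hGZK hEta hEta₀ hD hq hq8 hq7 hp8 hp7 hα hpq h2 hK hdK ι D₀ hc d
end Closers

end Summit.BirchSwinnertonDyer.BirchSwinnertonDyer.Theorems.GoldfeldGoodTwists

end
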